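import Literature.NumberTheory.Automorphic.ArchInnerFormSemiregularCentralizerBlock   -- ★ (M-UNFOLD) p850446: `gprimeBlock_eq_relabel_circleDiagonal`; brings ★ (V9) `exists_centralizer_continuousMulEquiv_of_splitSingular`, ★ relabel `e_τ`, ★ `endoEmb`, ★ `circleDiagonal_eq_endoEmb`
import Literature.NumberTheory.Automorphic.ArchInnerFormChartLocal                  -- ★ `gprimeBlockAt`, `chartTorusGLoc`, `chartTorusGLoc_le_centralizer`, `gprimeBlockAt_mem_chartTorusGLoc`
import HarnessLib

/-!
# The ONE-PLACE wall centraliser unfold: `Z_{U(α)_w}(s) ≃ₜ* U(σ_w diag(α_{τ0}, α_{τ2})) × U(σ_w α_{τ1})` at a semiregular compact-chart point `s = gprimeBlockAt α w S′ cw₀`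
# (`e^{i cw₀ 0} = e^{i cw₀ 2} ≠ e^{i cw₀ 1}`; Rogawski 1990 §4.12, §8.2 p. 122)

Topic `NumberTheory/Automorphic`; namespace `Literature.NumberTheory.Automorphic.UnitaryGroup`.  THEOREMS ONLY (no `def`, no instance, no notation, no axiom, no named fact,
no `sorry`).  Cell `pub/hodgecm-mathlib`, crux H413 (`stmt-HodgeConjecture-24833`), F0∕P3c line LH2 «N8-INNER», ROAD B, brick (8) «WALL EP GENERATOR» (binder LH1-p01 (g12)),
item (8c-spec-ii)(b) «ONE-PLACE UNFOLD» (token (t2) of the binder's 2026-09-02T16:54:07Z line: «there is NO one-place (M-UNFOLD) in the tree»), co-hand F0P2-p02 (g21).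
Count-neutral group-theoretic bookkeeping: nothing here closes an organ.

THE POINT.  The GLOBAL unfold ★ `exists_continuousMulEquiv_centralizer_gprimeTorus_semireg` (centraliser of `gprimeTorus α S′ p` in `G′_∞ = Π_w U(α)_w`) is assembled in its §A–§B
from a LOCAL model at `w₀`: ★ (V9) `exists_centralizer_continuousMulEquiv_of_splitSingular` — the centraliser of the STANDARD wall point `diag(z)` (`z 0 = z 2 ≠ z 1`) in
`U(σ_w diag α)(ℂ)` is the block group `U(σ_w diag(α₀,α₂)) × U(σ_w α₁)`, with inverse the block embedding `ι = endoEmb` ON THE NOSE — read in the RELABELLED frame `α ∘ τ₀`,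
`τ₀ = lineOf (formSign α w)`, through the relabelling isomorphism `e_{τ₀} : U(α ∘ τ₀)_w ≃ₜ* U(α)_w` (★ `ArchLocalRelabelTransport`), because the compact-chart point is
`gprimeBlockAt α w S′ c = e_{τ₀}(diag(e^{i c_k}))` (★ `gprimeBlock_eq_relabel_circleDiagonal`).  This file TRANSPORTS (V9) along `e_{τ₀}` to the one-place centraliser
`Z(s) := Subgroup.centralizer {gprimeBlockAt α w S′ cw₀} ≤ U(α)_w` (the binder's (t1) spelling, ★ (8b′) `exists_sliceGenerator_gprimeBlockAt_wall`):
* §1 (generic) **`exists_continuousMulEquiv_centralizer_map`** — a `ContinuousMulEquiv` `e : G ≃ₜ* G′` induces `Z_G(e⁻¹ x) ≃ₜ* Z_{G′}(x)` acting as `e` on carriers.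
* §2 **`exists_continuousMulEquiv_centralizer_gprimeBlockAt_wall`** — for `w ∉ S′` and `cw₀` with `Circle.exp (cw₀ 0) = Circle.exp (cw₀ 2) ≠ Circle.exp (cw₀ 1)`:
  `∃ e′ : ↥Z(s) ≃ₜ* ↥B_w × ↥U₁_w` (`B_w = unitaryGroupOfForm conj ((diagonal ![α (τ₀ 0), α (τ₀ 2)]).map σ_w)`, `U₁_w = unitaryGroupOfForm conj ((diagonal ![α (τ₀ 1)]).map σ_w)`) with
  (a) `↑(e′⁻¹ q) = e_{τ₀} (ι q)` for all `q` (the inverse IS the relabelled block embedding), and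
  (b) `e′ (gprimeBlockAt α w S′ c) = (diag(e^{i c 0}, e^{i c 2}), diag(e^{i c 1}))` for EVERY `c` — so the compact one-place torus `T′_{S′,w}` (generated by these points)
  goes to (the diagonal torus of `B_w`) × `U₁_w`, and `s` itself to `(e^{i cw₀ 0}·1, e^{i cw₀ 1})`.
(The Cayley-chart clause — the hyperbolic torus of `insert w S′` ↦ (hyperbolic torus of `B_w`) × `U₁_w` — is a computation on (a) with ★ `conj_monomialGL_boostStd_eq_gprimeSplitGL`,
left to the (8c-spec-ii)(c) assembly where its exact token is fixed by the binder's SEAMS memo.)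
HONEST LABEL: HC_CM is proved only modulo the 7 printed citations (2 remaining named inputs: hLiu418 = `stmt-HodgeConjecture-24832`, h413 = `stmt-HodgeConjecture-24833`) until
rung 0 closes; this file moves no row of the books.

## References
* [Rogawski1990] J. D. Rogawski, *Automorphic Representations of Unitary Groups in Three Variables*, Ann. of Math. Stud. 123 (1990), §4.12 Lemma 4.12.1 p. 66 (the centraliser
  `U(1,1) × U(1)` of a semiregular element), §8.2 p. 122, §4.8 Case (a) p. 53.
* [PlatonovRapinchuk1994] V. Platonov, A. Rapinchuk, *Algebraic Groups and Number Theory* (1994), §2.3 (centralisers of semisimple elements in classical groups).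
-/

set_option autoImplicit false

noncomputable section

open NumberField NumberField.InfinitePlace Matrix Complex Topology
open Literature.NumberTheory.Rogawski1990 Literature.LinearAlgebra.Matrix
open scoped MatrixGroups Matrix ComplexConjugate Classical

namespace Literature.NumberTheory.Automorphic.UnitaryGroup

/-! ## §1 (generic) Centralisers along an isomorphism of topological groups -/

section Generic

variable {G G' : Type*} [Group G] [Group G'] [TopologicalSpace G] [TopologicalSpace G']

/-- **A topological-group isomorphism `e : G ≃ₜ* G′` induces `Z_G(e⁻¹ x) ≃ₜ* Z_{G′}(x)`**, acting as `e` on the carriers (and as `e⁻¹` backwards).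
[cite: PlatonovRapinchuk1994, §2.3] -/
theorem exists_continuousMulEquiv_centralizer_map (e : G ≃ₜ* G') (x : G') :
    ∃ f : ↥(Subgroup.centralizer ({e.symm x} : Set G)) ≃ₜ* ↥(Subgroup.centralizer ({x} : Set G')),
      (∀ g, ((f g : ↥(Subgroup.centralizer ({x} : Set G'))) : G') = e (g : G)) ∧
      ∀ h, ((f.symm h : ↥(Subgroup.centralizer ({e.symm x} : Set G))) : G) = e.symm (h : G') := by
  have hto : ∀ g : G, g ∈ Subgroup.centralizer ({e.symm x} : Set G) → e g ∈ Subgroup.centralizer ({x} : Set G') := by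
    intro g hg
    rw [Subgroup.mem_centralizer_singleton_iff] at hg ⊢
    have h := congrArg e hg
    simpa only [map_mul, ContinuousMulEquiv.apply_symm_apply] using h
  have hfrom : ∀ h : G', h ∈ Subgroup.centralizer ({x} : Set G') → e.symm h ∈ Subgroup.centralizer ({e.symm x} : Set G) := by
    intro h hh
    rw [Subgroup.mem_centralizer_singleton_iff] at hh ⊢
    have h' := congrArg e.symm hh
    simpa only [map_mul] using h'
  let f₀ : ↥(Subgroup.centralizer ({e.symm x} : Set G)) ≃* ↥(Subgroup.centralizer ({x} : Set G')) :=
    { toFun := fun g => ⟨e (g : G), hto g g.2⟩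
      invFun := fun h => ⟨e.symm (h : G'), hfrom h h.2⟩
      left_inv := fun g => Subtype.ext (by simp)
      right_inv := fun h => Subtype.ext (by simp)
      map_mul' := fun a b => Subtype.ext (by simp [map_mul]) }
  have hc : Continuous f₀ := (e.continuous.comp continuous_subtype_val).subtype_mk _
  have hc' : Continuous f₀.symm := (e.symm.continuous.comp continuous_subtype_val).subtype_mk _
  exact ⟨{ f₀ with continuous_toFun := hc, continuous_invFun := hc' }, fun _ => rfl, fun _ => rfl⟩

end Generic

/-! ## §2 The one-place wall centraliser unfold -/

section LocalWall

variable (L : Type) [Field L] [NumberField L] [IsCMField L] (α : Fin 3 → L)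
  (S' : Finset {w : InfinitePlace L // IsComplex w}) (w : {w : InfinitePlace L // IsComplex w})

set_option maxHeartbeats 800000 in
/-- **ONE-PLACE WALL CENTRALISER UNFOLD.**  `w ∉ S′` a compact-chart place, `cw₀` a SEMIREGULAR compact-chart coordinate (`e^{i cw₀ 0} = e^{i cw₀ 2} ≠ e^{i cw₀ 1}`),
`s := gprimeBlockAt α w S′ cw₀`, `τ₀ := lineOf (formSign α w)`.  Then `Z(s) ≃ₜ* B_w × U₁_w` by an `e′` with (a) `↑(e′⁻¹ q) = e_{τ₀}(ι q)` (relabelled block embedding) and (b)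
`e′(gprimeBlockAt α w S′ c) = (diag(e^{ic₀}, e^{ic₂}), diag(e^{ic₁}))` for every `c`.  Transport of ★ (V9) along ★ `e_{τ₀}` (§1) via ★ `gprimeBlock_eq_relabel_circleDiagonal` and ★
`circleDiagonal_eq_endoEmb`. [cite: Rogawski1990, §4.12 Lemma 4.12.1 p. 66; §8.2 p. 122; §4.8 Case (a) p. 53] [cite: PlatonovRapinchuk1994, §2.3] -/
theorem exists_continuousMulEquiv_centralizer_gprimeBlockAt_wall (hw : w ∉ S') (cw₀ : Fin 3 → ℝ)
    (h02 : Circle.exp (cw₀ 0) = Circle.exp (cw₀ 2)) (h01 : Circle.exp (cw₀ 0) ≠ Circle.exp (cw₀ 1)) :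
    ∃ e' : ↥(Subgroup.centralizer ({gprimeBlockAt L α w S' cw₀} : Set ↥(archLocal L 3 (Matrix.diagonal α) w))) ≃ₜ*
        (↥(unitaryGroupOfForm (starRingEnd ℂ) ((Matrix.diagonal ![(α ∘ lineOf (formSign L α w)) 0, (α ∘ lineOf (formSign L α w)) 2]).map w.1.embedding)) ×
          ↥(unitaryGroupOfForm (starRingEnd ℂ) ((Matrix.diagonal ![(α ∘ lineOf (formSign L α w)) 1]).map w.1.embedding))),
      (∀ q, ((e'.symm q : ↥(Subgroup.centralizer ({gprimeBlockAt L α w S' cw₀} : Set ↥(archLocal L 3 (Matrix.diagonal α) w)))) : ↥(archLocal L 3 (Matrix.diagonal α) w)) =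
        (ContinuousMulEquiv.restrictSubgroup (GLn.conjEquiv (Matrix.GeneralLinearGroup.mkOfDetNeZero _ (det_monomial_one_ne_zero 3 (lineOf (formSign L α w)))))
            (archLocal L 3 (Matrix.diagonal (α ∘ (lineOf (formSign L α w)))) w) (archLocal L 3 (Matrix.diagonal α) w)
            (mem_archLocal_comp_perm_iff_conj_mem L 3 α w (lineOf (formSign L α w))))
          (endoEmb (starRingEnd ℂ) ((Matrix.diagonal ![(α ∘ lineOf (formSign L α w)) 0, (α ∘ lineOf (formSign L α w)) 2]).map w.1.embedding)
            ((Matrix.diagonal ![(α ∘ lineOf (formSign L α w)) 1]).map w.1.embedding)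
            ((Matrix.diagonal (α ∘ lineOf (formSign L α w))).map w.1.embedding) (endoForm_archLocal_diagonal L (α ∘ lineOf (formSign L α w)) w) q)) ∧
      (∀ c : Fin 3 → ℝ,
        e' ⟨gprimeBlockAt L α w S' c, chartTorusGLoc_le_centralizer L α w S' cw₀ (gprimeBlockAt_mem_chartTorusGLoc L α w S' c)⟩ =
          (⟨circleDiagonal 2 ![Circle.exp (c 0), Circle.exp (c 2)], (circleDiagonal_blocks_mem L (α ∘ lineOf (formSign L α w)) w (fun k => Circle.exp (c k))).1⟩,
           ⟨circleDiagonal 1 ![Circle.exp (c 1)], (circleDiagonal_blocks_mem L (α ∘ lineOf (formSign L α w)) w (fun k => Circle.exp (c k))).2⟩)) := by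
  -- notation
  set τ₀ : Equiv.Perm (Fin 3) := lineOf (formSign L α w) with hτ₀
  set eτ := (ContinuousMulEquiv.restrictSubgroup (GLn.conjEquiv (Matrix.GeneralLinearGroup.mkOfDetNeZero _ (det_monomial_one_ne_zero 3 τ₀)))
      (archLocal L 3 (Matrix.diagonal (α ∘ τ₀)) w) (archLocal L 3 (Matrix.diagonal α) w) (mem_archLocal_comp_perm_iff_conj_mem L 3 α w τ₀)) with heτ
  set ι := endoEmb (starRingEnd ℂ) ((Matrix.diagonal ![(α ∘ τ₀) 0, (α ∘ τ₀) 2]).map w.1.embedding) ((Matrix.diagonal ![(α ∘ τ₀) 1]).map w.1.embedding)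
      ((Matrix.diagonal (α ∘ τ₀)).map w.1.embedding) (endoForm_archLocal_diagonal L (α ∘ τ₀) w) with hι
  set z₀ : Fin 3 → Circle := fun k => Circle.exp (cw₀ k) with hz₀
  set d₀ : ↥(unitaryGroupOfForm (starRingEnd ℂ) ((Matrix.diagonal (α ∘ τ₀)).map w.1.embedding)) :=
    ⟨circleDiagonal 3 z₀, circleDiagonal_mem_archLocal_diagonal L 3 (α ∘ τ₀) w z₀⟩ with hd₀
  -- the wall point is the relabelled standard wall point
  have hs : gprimeBlockAt L α w S' cw₀ = eτ d₀ := by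
    rw [gprimeBlockAt]; exact gprimeBlock_eq_relabel_circleDiagonal L α hw (fun _ => cw₀)
  have hblk : ∀ c : Fin 3 → ℝ, gprimeBlockAt L α w S' c = eτ ⟨circleDiagonal 3 (fun k => Circle.exp (c k)), circleDiagonal_mem_archLocal_diagonal L 3 (α ∘ τ₀) w _⟩ := by
    intro c; rw [gprimeBlockAt]; exact gprimeBlock_eq_relabel_circleDiagonal L α hw (fun _ => c)
  -- ★ (V9) in the relabelled frame
  have hz02 : z₀ 0 = z₀ 2 := h02
  have hz01 : z₀ 0 ≠ z₀ 1 := h01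
  obtain ⟨e9, he9⟩ := exists_centralizer_continuousMulEquiv_of_splitSingular L (α ∘ τ₀) w (z := z₀) hz02 hz01
  -- §1 transport along `eτ`: note `eτ.symm s = d₀`
  have hsd : eτ.symm (gprimeBlockAt L α w S' cw₀) = d₀ := by rw [hs, ContinuousMulEquiv.symm_apply_apply]
  obtain ⟨f, hf, hfsymm⟩ := exists_continuousMulEquiv_centralizer_map eτ.symm d₀
  -- `f : Z(eτ.symm.symm d₀) ≃ₜ* Z(d₀)`; rewrite its source to `Z(s)`
  have hsrc : eτ.symm.symm d₀ = gprimeBlockAt L α w S' cw₀ := by rw [ContinuousMulEquiv.symm_symm, hs]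
  -- assemble: cast the source along `hsrc` by `Subgroup` equality
  have hZeq : Subgroup.centralizer ({eτ.symm.symm d₀} : Set ↥(archLocal L 3 (Matrix.diagonal α) w)) =
      Subgroup.centralizer ({gprimeBlockAt L α w S' cw₀} : Set ↥(archLocal L 3 (Matrix.diagonal α) w)) := by rw [hsrc]
  let castZ : ↥(Subgroup.centralizer ({gprimeBlockAt L α w S' cw₀} : Set ↥(archLocal L 3 (Matrix.diagonal α) w))) ≃ₜ*
      ↥(Subgroup.centralizer ({eτ.symm.symm d₀} : Set ↥(archLocal L 3 (Matrix.diagonal α) w))) :=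
    { MulEquiv.subgroupCongr hZeq.symm with
      continuous_toFun := continuous_induced_rng.2 continuous_subtype_val
      continuous_invFun := continuous_induced_rng.2 continuous_subtype_val }
  have hcastZ : ∀ g, ((castZ g : ↥(Subgroup.centralizer ({eτ.symm.symm d₀} : Set _))) : ↥(archLocal L 3 (Matrix.diagonal α) w)) = g := fun _ => rfl
  have hcastZ' : ∀ g, ((castZ.symm g : ↥(Subgroup.centralizer ({gprimeBlockAt L α w S' cw₀} : Set _))) : ↥(archLocal L 3 (Matrix.diagonal α) w)) = g :=
    fun _ => rfl
  refine ⟨(castZ.trans f).trans e9, fun q => ?_, fun c => ?_⟩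
  · -- (a) the inverse is `eτ ∘ ι`
    show ((castZ.symm (f.symm (e9.symm q)) : ↥(Subgroup.centralizer ({gprimeBlockAt L α w S' cw₀} : Set _))) : ↥(archLocal L 3 (Matrix.diagonal α) w)) = eτ (ι q)
    rw [hcastZ', hfsymm, ContinuousMulEquiv.symm_symm, he9 q]
  · -- (b) chart points go to the block diagonal pair
    show e9 (f (castZ ⟨gprimeBlockAt L α w S' c, _⟩)) = _
    apply e9.symm.injective
    rw [ContinuousMulEquiv.symm_apply_apply]
    apply Subtype.ext
    rw [he9, hf, hcastZ]
    show eτ.symm (gprimeBlockAt L α w S' c) = ι _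
    rw [hblk c, ContinuousMulEquiv.symm_apply_apply]
    exact circleDiagonal_eq_endoEmb L (α ∘ τ₀) w (fun k => Circle.exp (c k))

end LocalWall

end Literature.NumberTheory.Automorphic.UnitaryGroup

end
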